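import Literature.MathematicalPhysics.QuantumFieldTheory.Balaban1983to89.B6BlockDecayGLapBridgeV1

/-!
# `Balaban1983to89.B6BlockDecayLapHjV1` — T. Bałaban, *Propagators and renormalization transformations for lattice gauge theories. II*,
# Commun. Math. Phys. **96** (1984) 223–250 [Balaban1984PropagatorsII], (2.130) and Prop. 2.5 p. 246: THE SECOND-ORDER DERIVATIVES OF THE
# VECTOR MINIMIZER `H_j` — `ΔH_j = Σ_ν∇_ν*∇_νH_j` has an exponentially decaying BLOCK kernel for the concrete two-scale data `tsV1` at the paper's
# scaling, uniformly in the volume, `j`, `Λ′` and the weights — by [4] Proposition 1.2 (member `ΔGJ` of (1.110)) for `G_j` and the formula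
# `(Q_jG_jQ_j*)⁻¹ = Δ_j + a` for the averaged propagator; file 20 of the two-level decay programme

statement-level skeleton of published theorems with citation tags; proofs where landed; nothing here is a claim about the Yang–Mills mass gap

PDF held: `paper:balaban1984-cmp96-propagators-rt-ii` (journal page = PDF page + 222), p. 246 [PDF 24] (text layer, grepped by this seat's gen 14/15);
[4] = *Propagators … I*, CMP **95** (1984) 17–40 [Balaban1984PropagatorsI], Prop. 1.2 p. 35.  PRINT (verbatim, p. 246): *"we get the formula
H_j = G_jQ_j*(Q_jG_jQ_j*)⁻¹ (2.130) … From these representations we obtain all the necessary properties of the operators H_j, G̃_j. They follow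
from the Proposition 1.2 and from the formulas and the inequalities (1.99)–(1.101) for Q_jG_jQ_j*."*; [4] (1.110) p. 35: *"|(GJ)(x)|, |(∇GJ)(x)|,
|(G∇*J)(x)|, |(ΔGJ)(x)| ≤ O(1)e^{−δ₀|y−y′|}|J|"*.

CITATION HEADER (lean-in-tree rule) — WHAT IS REPRODUCED.  Phase-2 file of the `lit-balaban` typed skeleton (HOME `run/shared/lean/pub/lit-balaban/`),
seat **p22 gen 16**, lane B6 §C (fold owner r03, referee ref-4); SKELETON rows **B6.Eq2.130 / B6.Prop2.5** (cells only; decls of record untouched).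
The input `ΔH_j` of the member `|(ΔGJ)(x)|` of (1.110) in Prop. 2.5 for the genuine two-scale `G` of (2.90) (the unit's GEN16 plan, item 1 (iii)),
obtained EXACTLY along the printed sentence: (2.130) read at [4]'s weight (`H_j = G^{(w′)}Q_j*E^{(w′)}`, `E^{(w′)} = (Q_jG^{(w′)}Q_j*)⁻¹`, file 1's
weight freedom), [4] Proposition 1.2 for `G^{(w′)} = G_j` (its member `ΔGJ`: file 18's `blockBound_LapGE_scaling`, B5's theorem BY NAME), and *"the
formulas for Q_jG_jQ_j*"*: §1 **`Ej_weight_eq`** — for EVERY positive-definite weight `a′`, `(Q_jG′Q_j*)⁻¹ = Δ_j + a′` with `G′ = (M_j + Q_j*a′Q_j)⁻¹`,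
`Δ_j = H_j*M_jH_j` ((2.118), [4] (1.66)–(1.67): the averaged propagator's inverse is the unit-lattice operator `Δ_j` shifted by the weight; the
tree's `…B6Eq2118DeltaJInverse.Δj_eq_Ej_sub_id` is the case `a′ = 1`), hence **`Hj_eq_comp_weight`**: `H_j = G′Q_j*(Δ_j + a′)`; for `tsV1` and a
scalar weight `w′`: `Hj_eq_GE_comp_V1` (`G′ =` r03's `GE` of the whole torus of order `j`, file 6's `inverse_MjQ_smul_apply`).  §2 `Q_j*` (fine ← unit)
has the block bound `(η^{d+1}e^{δ}, δ)` for every `δ ≥ 0` (`blockBound_Qv_adjoint`: p09's averaging kernel, its COLUMN sums `QsStd_row` = 1 and range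
`QsStd_range`).  §3 `Δ_j` (unit ← unit) has the block bound `(κ·A_Δ·(d+1), κ_Δ)` (`blockBound_Δj`: gen 12's `kernel_Δj_decay`, `κ = c²/(η^{d+1}n²)`).
§4 **`blockBound_LapHj_scaling`**: at `c = L^j` (`κ = n^{d+1}`, `w′ = n^{d+1}` = [4]'s `a = 1`) there are `δ > 0`, `C ≥ 0` depending on `d, L` only with
`Σ_{b : b₋ = y}|(Σ_ν∇_ν*∇_ν H_j)(e_b)_{b₀}| ≤ C·e^{−δ|y(b₀₋) − y|_T}` for every volume, `j + 1 ≤ m + K`, `Λ′`, positive weights — `ΔH_j = (ΔG^{(w′)})∘(Q_j*(Δ_j + w′))`,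
the factor `η^{d+1}` of `Q_j*` against the factor `n^{d+1}` of `Δ_j + w′` (file 2's `blockBound_comp`, no volume factor).
IMPORTS BY NAME, restating nothing.  THEOREMS ONLY (no `def`, no `def … : Prop`); standard axioms.
HONEST SCOPE: (i) `Δ = Σ_ν∇_ν*∇_ν` componentwise on fine bond fields with the factor `n = L^j` (file 18's spelling; `= ∂*∂ + ∂∂*` on the lattice,
[4] (1.21)); (ii) finite tori `⟨d + 1, L, m, K, _, _⟩`, `c = L^j` in §4; constants ours and crude; (iii) the identity of §1 is finite-dimensional linear
algebra under the printed lattice identities (`IsLattice`) and positivity (`Positive`), theorems for `tsV1`; NOT summit progress.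
Unit `lit-balaban-p22` (gen 16), 2026-08-22.
-/

noncomputable section

open scoped InnerProductSpace BigOperators Matrix
open Finset

namespace Literature.MathematicalPhysics.QuantumFieldTheory.Balaban1983to89.B6BlockDecayLapHjV1

open LatticeFieldCalculus B5SectBStatements B5Eq117TorusCarriers B6SectADomainsV1 B6SectAOperatorsV1 B6SectAVectorModelV1 B6SectCOperators
  B6SectCTwoScaleV1 B6SectCTwoScaleV1Lattice B5Eq118OneStroke
open BalabanImbrieJaffe1984to88.BIJ85AxialPropagator411 (BondSpace)
open B4Sect5Torus (IsPseudoDist SumBound)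
open B4TorusKernel (periodConst)
open B4TorusKernel.MultiPeriod (torusSupNorm torusSupNorm_nonneg)
open B4Sect5Proof (latticeConst latticeConst_nonneg)
open B5Kernel166Decay (periodConst_pos)
open B5Symbol166Strip (kappa166 kappa166_pos MW_pos)
open B12Eq443LatticeMoments (MC)
open B6LowerBound2153Torus (rep)
open B6SectCPositivity (Qv_Hj)
open B6Repr2129Operator (Hj_apply_weight MjQa_comp_inverse QGaQ_comp_inverse Hj_eq_hOp_weight)
open B6BlockDecayCalculus (blockBound_comp blockBound_add blockBound_smul blockBound_id blockBound_of_entry adjoint_entry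
  torusDist_isPseudoDist torusDist_sumBound)
open B6BlockDecayHjCovV1 (card_fiber_src_le)
open B6BlockDecayHprimeCovV1 (supDist_cast_eq_torusSupNorm)
open B6BlockDecayGtV1 (inverse_MjQ_smul_apply Qv_single_apply)
open B6BlockDecayGLapBridgeV1 (blockBound_LapGE_scaling)
open B6DeltaJKernelTwoScaleV1 (kernel_Δj_decay)
open BalabanImbrieJaffe1984to88.BIJ85Ineq722Torus (QsStd QsStd_nonneg QsStd_row QsStd_range)

/-! ## §1  `(Q_jG′Q_j*)⁻¹ = Δ_j + a′` and `H_j = G′Q_j*(Δ_j + a′)` for every positive-definite weight `a′` -/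

section Abstract

variable {A B W T Bs V : Type*}
  [NormedAddCommGroup A] [InnerProductSpace ℝ A] [FiniteDimensional ℝ A]
  [NormedAddCommGroup B] [InnerProductSpace ℝ B] [FiniteDimensional ℝ B]
  [NormedAddCommGroup W] [InnerProductSpace ℝ W] [FiniteDimensional ℝ W]
  [NormedAddCommGroup T] [InnerProductSpace ℝ T] [FiniteDimensional ℝ T]
  [NormedAddCommGroup Bs] [InnerProductSpace ℝ Bs] [FiniteDimensional ℝ Bs]
  [NormedAddCommGroup V] [InnerProductSpace ℝ V] [FiniteDimensional ℝ V]
  {D : TwoScaleData A B W T Bs V} (a' : Bs →ₗ[ℝ] Bs)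

/-- **`(Δ − ∂P_j∂*)H_j = Q_j*(E′ − a′)`** for every positive-definite weight `a′`, `E′ = (Q_jG′Q_j*)⁻¹`, `G′ = (M_j + Q_j*a′Q_j)⁻¹`: from
`(M_j + Q_j*a′Q_j)G′ = I`, `H_j = G′Q_j*E′` (2.130, file 1's weight freedom) and `Q_jG′Q_j*E′ = I` (the tree's `…B6Eq2118DeltaJInverse.Mj_Hj` is the
case `a′ = 1`). [cite: Balaban1984PropagatorsII, (2.113) p.243 + (2.130) p.246] -/
theorem Mj_Hj_weight (hL : D.IsLattice) (hP : D.Positive) (hap : ∀ x : Bs, x ≠ 0 → 0 < ⟪x, a' x⟫_ℝ) (b : Bs) :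
    D.Mj (D.Hj b) =
      LinearMap.adjoint D.Qv (Ring.inverse (D.Qv ∘ₗ Ring.inverse (D.Mj + LinearMap.adjoint D.Qv ∘ₗ a' ∘ₗ D.Qv) ∘ₗ LinearMap.adjoint D.Qv) b) -
        LinearMap.adjoint D.Qv (a' b) := by
  have h1 : D.Hj b = Ring.inverse (D.Mj + LinearMap.adjoint D.Qv ∘ₗ a' ∘ₗ D.Qv) (LinearMap.adjoint D.Qv
      (Ring.inverse (D.Qv ∘ₗ Ring.inverse (D.Mj + LinearMap.adjoint D.Qv ∘ₗ a' ∘ₗ D.Qv) ∘ₗ LinearMap.adjoint D.Qv) b)) :=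
    Hj_apply_weight a' hL hP hap b
  -- `(M_j + Q_j*a′Q_j)G′z = z`
  have h2 : ∀ z : A, D.Mj (Ring.inverse (D.Mj + LinearMap.adjoint D.Qv ∘ₗ a' ∘ₗ D.Qv) z) +
      LinearMap.adjoint D.Qv (a' (D.Qv (Ring.inverse (D.Mj + LinearMap.adjoint D.Qv ∘ₗ a' ∘ₗ D.Qv) z))) = z := by
    intro z
    have h := LinearMap.congr_fun (MjQa_comp_inverse a' hL hP hap) z
    simpa only [LinearMap.comp_apply, LinearMap.add_apply, LinearMap.id_apply] using h
  -- `Q_jG′Q_j*E′b = b`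
  have h3 : D.Qv (Ring.inverse (D.Mj + LinearMap.adjoint D.Qv ∘ₗ a' ∘ₗ D.Qv) (LinearMap.adjoint D.Qv
      (Ring.inverse (D.Qv ∘ₗ Ring.inverse (D.Mj + LinearMap.adjoint D.Qv ∘ₗ a' ∘ₗ D.Qv) ∘ₗ LinearMap.adjoint D.Qv) b))) = b := by
    have h := LinearMap.congr_fun (QGaQ_comp_inverse a' hL hP hap) b
    simpa only [LinearMap.comp_apply, LinearMap.id_apply] using h
  have h4 := h2 (LinearMap.adjoint D.Qv
    (Ring.inverse (D.Qv ∘ₗ Ring.inverse (D.Mj + LinearMap.adjoint D.Qv ∘ₗ a' ∘ₗ D.Qv) ∘ₗ LinearMap.adjoint D.Qv) b))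
  rw [h3] at h4
  rw [h1, eq_sub_iff_add_eq]
  exact h4

/-- **`(Q_jG′Q_j*)⁻¹ = Δ_j + a′` FOR EVERY POSITIVE-DEFINITE WEIGHT `a′`** (`G′ = (Δ − ∂P_j∂* + Q_j*a′Q_j)⁻¹`, `Δ_j = H_j*(Δ − ∂P_j∂*)H_j` the operator of
the quadratic form (2.118)): *"the formulas … for Q_jG_jQ_j*"* of the sentence after (2.131) — `H_j*Q_j* = (Q_jH_j)* = I` applied to `Mj_Hj_weight`
(the tree's `Δj_eq_Ej_sub_id` is the case `a′ = 1`; [4] (1.66)–(1.67) `⟨H_kB, Δ_aH_kB⟩ = ⟨B, Δ_kB⟩ + a‖B‖²`).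
[cite: Balaban1984PropagatorsII, (2.118) p.243 + (2.130)–(2.131) p.246; Balaban1984PropagatorsI, (1.66)–(1.67) p.29] -/
theorem Ej_weight_eq (hL : D.IsLattice) (hP : D.Positive) (hap : ∀ x : Bs, x ≠ 0 → 0 < ⟪x, a' x⟫_ℝ) :
    Ring.inverse (D.Qv ∘ₗ Ring.inverse (D.Mj + LinearMap.adjoint D.Qv ∘ₗ a' ∘ₗ D.Qv) ∘ₗ LinearMap.adjoint D.Qv) = D.Δj + a' := by
  refine LinearMap.ext fun b => ext_inner_left ℝ fun x => ?_
  have h : ⟪x, D.Δj b⟫_ℝ =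
      ⟪x, Ring.inverse (D.Qv ∘ₗ Ring.inverse (D.Mj + LinearMap.adjoint D.Qv ∘ₗ a' ∘ₗ D.Qv) ∘ₗ LinearMap.adjoint D.Qv) b⟫_ℝ - ⟪x, a' b⟫_ℝ := by
    rw [show D.Δj b = LinearMap.adjoint D.Hj (D.Mj (D.Hj b)) from rfl, LinearMap.adjoint_inner_right, Mj_Hj_weight a' hL hP hap b,
      inner_sub_right, LinearMap.adjoint_inner_right, LinearMap.adjoint_inner_right, Qv_Hj hL hP]
  rw [LinearMap.add_apply, inner_add_right, h]
  ring

/-- **`H_j = G′Q_j*(Δ_j + a′)` FOR EVERY POSITIVE-DEFINITE WEIGHT `a′`** — (2.130) at the weight `a′` with the averaged propagator's inverse written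
through `Δ_j`. [cite: Balaban1984PropagatorsII, (2.130) p.246 + (2.118) p.243] -/
theorem Hj_eq_comp_weight (hL : D.IsLattice) (hP : D.Positive) (hap : ∀ x : Bs, x ≠ 0 → 0 < ⟪x, a' x⟫_ℝ) :
    D.Hj = Ring.inverse (D.Mj + LinearMap.adjoint D.Qv ∘ₗ a' ∘ₗ D.Qv) ∘ₗ LinearMap.adjoint D.Qv ∘ₗ (D.Δj + a') := by
  rw [Hj_eq_hOp_weight a' hL hP hap, ← Ej_weight_eq a' hL hP hap]
  rfl

end Abstract

/-! ### For the concrete two-scale data `tsV1` and a scalar weight `w′` -/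

section Concrete

variable {P : Params} {c : ℝ} (hc : c ≠ 0) {j : ℕ} (hj : j + 1 ≤ P.m + P.K) (Λ' : Finset (Site P (j + 1)))
  {w : CIdx j Λ' → ℝ} (hw : ∀ i, 0 < w i)

include hj hw

/-- **`(Q_jG^{(w′)}Q_j*)⁻¹ = Δ_j + w′` for `tsV1` and every `w′ > 0`.** [cite: Balaban1984PropagatorsII, (2.118) p.243 + (2.130) p.246] -/
theorem Ej_smul_eq_V1 {w' : ℝ} (hw' : 0 < w') :
    Ring.inverse ((tsV1 hc Λ' w).Qv ∘ₗ
        Ring.inverse ((tsV1 hc Λ' w).Mj + LinearMap.adjoint (tsV1 hc Λ' w).Qv ∘ₗ (w' • LinearMap.id) ∘ₗ (tsV1 hc Λ' w).Qv) ∘ₗ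
          LinearMap.adjoint (tsV1 hc Λ' w).Qv) =
      (tsV1 hc Λ' w).Δj + w' • LinearMap.id :=
  Ej_weight_eq (w' • LinearMap.id) (isLattice Λ' hc hj hw) (positive Λ' hc hj w) (fun x hx => by
    rw [LinearMap.smul_apply, LinearMap.id_apply, real_inner_smul_right, real_inner_self_eq_norm_sq]
    exact mul_pos hw' (by positivity))

/-- **`H_j = G^{(w′)}Q_j*(Δ_j + w′)` for `tsV1` and every `w′ > 0`**, `G^{(w′)} = G` (2.22) of the whole-torus family of order `j` with the constant
weight `w′` (file 6's `inverse_MjQ_smul_apply`). [cite: Balaban1984PropagatorsII, (2.130) p.246 + (2.22) p.226] -/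
theorem Hj_eq_GE_comp_V1 {w' : ℝ} (hw' : 0 < w') :
    (tsV1 hc Λ' w).Hj = GE (Domains.whole (P := P) j (Nat.le_of_succ_le hj)) hc (w := fun _ => w') (fun _ => hw') ∘ₗ
      LinearMap.adjoint (tsV1 hc Λ' w).Qv ∘ₗ ((tsV1 hc Λ' w).Δj + w' • LinearMap.id) := by
  rw [Hj_eq_comp_weight (w' • LinearMap.id) (isLattice Λ' hc hj hw) (positive Λ' hc hj w) (fun x hx => by
    rw [LinearMap.smul_apply, LinearMap.id_apply, real_inner_smul_right, real_inner_self_eq_norm_sq]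
    exact mul_pos hw' (by positivity))]
  congr 1
  exact LinearMap.ext fun v => inverse_MjQ_smul_apply hc hj Λ' hw hw' v

end Concrete

/-! ## §2  `Q_j*` (fine bonds ← unit bonds) has the block bound `(η^{d+1}e^{δ}, δ)` for every `δ ≥ 0` -/

section QvAdjoint

variable {d L m K : ℕ} {hd : 1 ≤ d + 1} {hL : Odd L ∧ 1 < L} {c : ℝ} (hc : c ≠ 0) {j : ℕ}
  (hj' : j ≤ (⟨d + 1, L, m, K, hd, hL⟩ : Params).m + (⟨d + 1, L, m, K, hd, hL⟩ : Params).K)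
  (Λ' : Finset (Site (⟨d + 1, L, m, K, hd, hL⟩ : Params) (j + 1))) (w : CIdx j Λ' → ℝ)
  [DecidableEq (PBond (⟨d + 1, L, m, K, hd, hL⟩ : Params) 0)] [DecidableEq (PBond (⟨d + 1, L, m, K, hd, hL⟩ : Params) j)]

include hj' in
/-- **the entries of `Q_j*`** (the transposed averaging kernel of (1.18)): `Q_j*(e_b)_{b₀} = Q_j(e_{b₀})_b = η^{d+1}·Q^*_{std}(b₀, b)`.
[cite: Balaban1984PropagatorsI, (1.18) p.20; Balaban1984PropagatorsII, (2.130) p.246] -/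
theorem Qv_adjoint_single_apply (b : PBond (⟨d + 1, L, m, K, hd, hL⟩ : Params) j) (b₀ : PBond (⟨d + 1, L, m, K, hd, hL⟩ : Params) 0) :
    LinearMap.adjoint (tsV1 hc Λ' w).Qv (EuclideanSpace.single b (1 : ℝ)) b₀ =
      (⟨d + 1, L, m, K, hd, hL⟩ : Params).eta j ^ (d + 1) * QsStd (⟨d + 1, L, m, K, hd, hL⟩ : Params) j (b₀.src, b₀.dir) (b.src, b.dir) := by
  rw [adjoint_entry, Qv_single_apply hc hj' Λ' w]

include hj' in
/-- **`Q_j*` HAS THE BLOCK BOUND `(η^{d+1}e^{δ}, δ)` FOR EVERY `δ ≥ 0`** (fine bonds ← unit bonds): `Σ_{b : b₋ = y′}|Q_j*(e_b)_{b₀}| ≤ η^{d+1}e^{δ}e^{−δ|y(b₀₋) − y′|_T}`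
— the column mass of the averaging kernel is `Σ_b Q(b, b₀) = η^{d+1}` (`QsStd_row`: every fine bond is read with total weight `η^{d+1}`) and an entry
vanishes unless `|y(b₀₋) − b₋| ≤ 1` (`QsStd_range`). [cite: Balaban1984PropagatorsI, (1.18) p.20; Balaban1984PropagatorsII, (2.130) p.246] -/
theorem blockBound_Qv_adjoint {δ : ℝ} (hδ : 0 ≤ δ) (b₀ : PBond (⟨d + 1, L, m, K, hd, hL⟩ : Params) 0) (y' : Site (⟨d + 1, L, m, K, hd, hL⟩ : Params) j) :
    ∑ b ∈ univ.filter (fun b : PBond (⟨d + 1, L, m, K, hd, hL⟩ : Params) j => b.src = y'),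
        |LinearMap.adjoint (tsV1 hc Λ' w).Qv (EuclideanSpace.single b (1 : ℝ)) b₀| ≤
      (⟨d + 1, L, m, K, hd, hL⟩ : Params).eta j ^ (d + 1) * Real.exp δ *
        Real.exp (-(δ * torusSupNorm (Mk (⟨d + 1, L, m, K, hd, hL⟩ : Params) j)
          (rep (Mk (⟨d + 1, L, m, K, hd, hL⟩ : Params) j) (iterBlockOf j b₀.src) - rep (Mk (⟨d + 1, L, m, K, hd, hL⟩ : Params) j) y'))) := by
  have hρ : IsPseudoDist (fun t t' : Site (⟨d + 1, L, m, K, hd, hL⟩ : Params) j => torusSupNorm (Mk (⟨d + 1, L, m, K, hd, hL⟩ : Params) j)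
      (rep (Mk (⟨d + 1, L, m, K, hd, hL⟩ : Params) j) t - rep (Mk (⟨d + 1, L, m, K, hd, hL⟩ : Params) j) t')) :=
    torusDist_isPseudoDist (Mk (⟨d + 1, L, m, K, hd, hL⟩ : Params) j)
  have hη : 0 ≤ (⟨d + 1, L, m, K, hd, hL⟩ : Params).eta j ^ (d + 1) :=
    pow_nonneg (pow_nonneg (inv_nonneg.mpr (Nat.cast_nonneg _)) _) _
  by_cases hfar : torusSupNorm (Mk (⟨d + 1, L, m, K, hd, hL⟩ : Params) j)
      (rep (Mk (⟨d + 1, L, m, K, hd, hL⟩ : Params) j) (iterBlockOf j b₀.src) - rep (Mk (⟨d + 1, L, m, K, hd, hL⟩ : Params) j) y') ≤ 1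
  · -- the whole column mass is `η^{d+1}`
    have h1 : ∑ b ∈ univ.filter (fun b : PBond (⟨d + 1, L, m, K, hd, hL⟩ : Params) j => b.src = y'),
          |LinearMap.adjoint (tsV1 hc Λ' w).Qv (EuclideanSpace.single b (1 : ℝ)) b₀| ≤ (⟨d + 1, L, m, K, hd, hL⟩ : Params).eta j ^ (d + 1) := by
      calc ∑ b ∈ univ.filter (fun b : PBond (⟨d + 1, L, m, K, hd, hL⟩ : Params) j => b.src = y'),
            |LinearMap.adjoint (tsV1 hc Λ' w).Qv (EuclideanSpace.single b (1 : ℝ)) b₀|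
          ≤ ∑ b : PBond (⟨d + 1, L, m, K, hd, hL⟩ : Params) j, |LinearMap.adjoint (tsV1 hc Λ' w).Qv (EuclideanSpace.single b (1 : ℝ)) b₀| :=
            Finset.sum_le_sum_of_subset_of_nonneg (Finset.filter_subset _ _) fun _ _ _ => abs_nonneg _
        _ = ∑ p : Site (⟨d + 1, L, m, K, hd, hL⟩ : Params) j × Fin (d + 1),
              |(⟨d + 1, L, m, K, hd, hL⟩ : Params).eta j ^ (d + 1) * QsStd (⟨d + 1, L, m, K, hd, hL⟩ : Params) j (b₀.src, b₀.dir) p| :=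
            Fintype.sum_equiv (LatticeFieldCalculus.bondEquiv (P := (⟨d + 1, L, m, K, hd, hL⟩ : Params)) (j := j)).symm
              (fun b : PBond (⟨d + 1, L, m, K, hd, hL⟩ : Params) j => |LinearMap.adjoint (tsV1 hc Λ' w).Qv (EuclideanSpace.single b (1 : ℝ)) b₀|)
              (fun p => |(⟨d + 1, L, m, K, hd, hL⟩ : Params).eta j ^ (d + 1) * QsStd (⟨d + 1, L, m, K, hd, hL⟩ : Params) j (b₀.src, b₀.dir) p|)
              fun b => by rw [Qv_adjoint_single_apply hc hj' Λ' w]; rfl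
        _ = (⟨d + 1, L, m, K, hd, hL⟩ : Params).eta j ^ (d + 1) *
              ∑ p : Site (⟨d + 1, L, m, K, hd, hL⟩ : Params) j × Fin (d + 1), |QsStd (⟨d + 1, L, m, K, hd, hL⟩ : Params) j (b₀.src, b₀.dir) p| := by
            rw [Finset.mul_sum]
            exact Finset.sum_congr rfl fun p _ => by rw [abs_mul, abs_of_nonneg hη]
        _ = (⟨d + 1, L, m, K, hd, hL⟩ : Params).eta j ^ (d + 1) := by
            rw [QsStd_row (P := (⟨d + 1, L, m, K, hd, hL⟩ : Params)) (k := j) (b₀.src, b₀.dir), mul_one]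
    refine h1.trans ?_
    rw [mul_assoc, ← Real.exp_add]
    refine le_mul_of_one_le_right hη (Real.one_le_exp ?_)
    nlinarith [mul_nonneg hδ (sub_nonneg.2 hfar)]
  · -- no unit bond at `y′` reads a fine bond of the block of `b₀`
    have h0 : ∑ b ∈ univ.filter (fun b : PBond (⟨d + 1, L, m, K, hd, hL⟩ : Params) j => b.src = y'),
          |LinearMap.adjoint (tsV1 hc Λ' w).Qv (EuclideanSpace.single b (1 : ℝ)) b₀| = 0 := by
      refine Finset.sum_eq_zero fun b hb => ?_
      rw [Qv_adjoint_single_apply hc hj' Λ' w, abs_eq_zero]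
      by_contra hne
      have hQ : QsStd (⟨d + 1, L, m, K, hd, hL⟩ : Params) j (b₀.src, b₀.dir) (b.src, b.dir) ≠ 0 := fun h => hne (by rw [h, mul_zero])
      have hr := QsStd_range hj' (b₀.src, b₀.dir) (b.src, b.dir) hQ
      rw [show (b₀.src, b₀.dir).1 = b₀.src from rfl, show (b.src, b.dir).1 = b.src from rfl, (Finset.mem_filter.mp hb).2,
        supDist_cast_eq_torusSupNorm] at hr
      exact hfar hr
    rw [h0]
    positivity

end QvAdjoint

/-! ## §3  `Δ_j` (unit bonds ← unit bonds) has the block bound `(κ·A_Δ·(d+1), κ_Δ)` -/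

section DeltaJ

variable {d L m K : ℕ} {hd : 1 ≤ d + 1} {hL : Odd L ∧ 1 < L} {c : ℝ} (hc : c ≠ 0) {j : ℕ}
  (hj : j + 1 ≤ (⟨d + 1, L, m, K, hd, hL⟩ : Params).m + (⟨d + 1, L, m, K, hd, hL⟩ : Params).K)
  (Λ' : Finset (Site (⟨d + 1, L, m, K, hd, hL⟩ : Params) (j + 1))) {w : CIdx j Λ' → ℝ} (hw : ∀ i, 0 < w i)
  [DecidableEq (PBond (⟨d + 1, L, m, K, hd, hL⟩ : Params) j)]

/-- `0 ≤ A_Δ = M_C(d+1, κ₁₆₆)·periodConst(κ₁₆₆, d)` (the constant of gen 12's `kernel_Δj_decay`). [cite: Balaban1984PropagatorsII, p.250 (text before (2.157))] -/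
theorem ADelta_nonneg (d : ℕ) : 0 ≤ MC (d + 1) (kappa166 (d + 1)) * periodConst (kappa166 (d + 1)) d := by
  have h1 : 0 ≤ MC (d + 1) (kappa166 (d + 1)) := by
    unfold MC
    have := MW_pos (d + 1)
    positivity
  exact mul_nonneg h1 (periodConst_pos (kappa166_pos _) _).le

include hj hw in
/-- **`Δ_j` HAS THE BLOCK BOUND `(κ·A_Δ·(d+1), κ₁₆₆/(d+1))`** (unit bonds ← unit bonds; `κ = c²/(η^{d+1}n²)`): the entry decay of gen 12's `kernel_Δj_decay`
over the `d + 1` unit bonds at a unit site. [cite: Balaban1984PropagatorsII, (2.118) p.243, p.250 (text before (2.157))] -/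
theorem blockBound_Δj (b : PBond (⟨d + 1, L, m, K, hd, hL⟩ : Params) j) (y' : Site (⟨d + 1, L, m, K, hd, hL⟩ : Params) j) :
    ∑ b' ∈ univ.filter (fun b' : PBond (⟨d + 1, L, m, K, hd, hL⟩ : Params) j => b'.src = y'), |(tsV1 hc Λ' w).Δj (EuclideanSpace.single b' (1 : ℝ)) b| ≤
      c ^ 2 / (eta L j ^ (d + 1) * ((L : ℝ) ^ j) ^ 2) * (MC (d + 1) (kappa166 (d + 1)) * periodConst (kappa166 (d + 1)) d) * ((1 * (d + 1) : ℕ) : ℝ) *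
        Real.exp (-(kappa166 (d + 1) / (d + 1) * torusSupNorm (Mk (⟨d + 1, L, m, K, hd, hL⟩ : Params) j)
          (rep (Mk (⟨d + 1, L, m, K, hd, hL⟩ : Params) j) b.src - rep (Mk (⟨d + 1, L, m, K, hd, hL⟩ : Params) j) y'))) := by
  have hκ : 0 ≤ c ^ 2 / (eta L j ^ (d + 1) * ((L : ℝ) ^ j) ^ 2) :=
    (B6Ineq2118TwoScaleV1.kappa_pos (P := (⟨d + 1, L, m, K, hd, hL⟩ : Params)) hc (j := j)).le
  refine blockBound_of_entry (ρ := (fun t t' : Site (⟨d + 1, L, m, K, hd, hL⟩ : Params) j => torusSupNorm (Mk (⟨d + 1, L, m, K, hd, hL⟩ : Params) j)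
      (rep (Mk (⟨d + 1, L, m, K, hd, hL⟩ : Params) j) t - rep (Mk (⟨d + 1, L, m, K, hd, hL⟩ : Params) j) t'))) (tsV1 hc Λ' w).Δj
    (fun b : PBond (⟨d + 1, L, m, K, hd, hL⟩ : Params) j => b.src) (fun b : PBond (⟨d + 1, L, m, K, hd, hL⟩ : Params) j => b.src)
    (mul_nonneg hκ (ADelta_nonneg d)) (card_fiber_src_le (P := (⟨d + 1, L, m, K, hd, hL⟩ : Params))) (fun b b' => ?_) b y'
  have h := kernel_Δj_decay hc Λ' hw hj b b'
  rw [EuclideanSpace.inner_single_left, map_one, one_mul] at h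
  refine h.trans (le_of_eq ?_)
  ring

end DeltaJ

/-! ## §4  `ΔH_j` at the paper's scaling: a block bound uniform in the volume, `j`, `Λ′`, the weights -/

section Scaling

variable {d L m K : ℕ} {hd : 1 ≤ d + 1} {hL : Odd L ∧ 1 < L} {j : ℕ}

open Classical in
/-- **THE SECOND-ORDER DERIVATIVES OF `H_j`: `ΔH_j = Σ_ν∇_ν*∇_νH_j` HAS AN EXPONENTIALLY DECAYING BLOCK KERNEL, UNIFORMLY** (at `c = L^j`): there are `δ > 0`,
`C ≥ 0` depending on `d, L` only such that for every volume `(m, K)`, every `j + 1 ≤ m + K`, every `Λ′ ⊂ T^{(j+1)}`, all positive weights and all fine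
bonds `b₀`, unit sites `y`: `Σ_{b : b₋ = y}|(ΔH_j)(e_b)_{b₀}| ≤ C·e^{−δ|y(b₀₋) − y|_T}` — `ΔH_j = (ΔG^{(n^{d+1})})∘(Q_j*(Δ_j + n^{d+1}))` (§1 at `w′ = n^{d+1}`,
[4]'s `a = 1`), `ΔG^{(n^{d+1})}` `(O(1), δ₀)` by [4] Prop. 1.2 (file 18), `Q_j*` `(η^{d+1}e^{κ_Δ}, κ_Δ)` (§2), `Δ_j + n^{d+1}` `(n^{d+1}(A_Δ(d+1) + 1), κ_Δ)`
(§3), composed by file 2 (`η^{d+1}·n^{d+1} = 1`, no volume factor). [cite: Balaban1984PropagatorsII, (2.130) p.246, Prop. 2.5 p.246; Balaban1984PropagatorsI, Prop. 1.2 (1.110) p.35] -/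
theorem blockBound_LapHj_scaling (d L : ℕ) (hd : 1 ≤ d + 1) (hL : Odd L ∧ 1 < L) :
    ∃ δ : ℝ, 0 < δ ∧ ∃ C : ℝ, 0 ≤ C ∧ ∀ (m K : ℕ) (j : ℕ) (hc : ((L : ℝ) ^ j) ≠ 0)
      (hj : j + 1 ≤ (⟨d + 1, L, m, K, hd, hL⟩ : Params).m + (⟨d + 1, L, m, K, hd, hL⟩ : Params).K)
      (Λ' : Finset (Site (⟨d + 1, L, m, K, hd, hL⟩ : Params) (j + 1))) (w : CIdx j Λ' → ℝ) (_hw : ∀ i, 0 < w i)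
      (b₀ : PBond (⟨d + 1, L, m, K, hd, hL⟩ : Params) 0) (y : Site (⟨d + 1, L, m, K, hd, hL⟩ : Params) j),
      ∑ b ∈ univ.filter (fun b : PBond (⟨d + 1, L, m, K, hd, hL⟩ : Params) j => b.src = y),
          |((∑ ν : Fin (d + 1), ((((L : ℝ) ^ j) • (onE (LinearMap.funLeft ℝ ℝ (fun b : PBond (⟨d + 1, L, m, K, hd, hL⟩ : Params) 0 => (⟨b.src.unshift ν, b.dir⟩ : PBond (⟨d + 1, L, m, K, hd, hL⟩ : Params) 0))) - LinearMap.id) : BondSpace (⟨d + 1, L, m, K, hd, hL⟩ : Params) →ₗ[ℝ] BondSpace (⟨d + 1, L, m, K, hd, hL⟩ : Params))) ∘ₗ ((((L : ℝ) ^ j) • (onE (LinearMap.funLeft ℝ ℝ (fun b : PBond (⟨d + 1, L, m, K, hd, hL⟩ : Params) 0 => (⟨b.src.shift ν, b.dir⟩ : PBond (⟨d + 1, L, m, K, hd, hL⟩ : Params) 0))) - LinearMap.id) : BondSpace (⟨d + 1, L, m, K, hd, hL⟩ : Params) →ₗ[ℝ] BondSpace (⟨d + 1, L, m, K, hd, hL⟩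 : Params)))) ∘ₗ
            (tsV1 hc Λ' w).Hj) (EuclideanSpace.single b (1 : ℝ)) b₀| ≤
        C * Real.exp (-(δ * torusSupNorm (Mk (⟨d + 1, L, m, K, hd, hL⟩ : Params) j)
            (rep (Mk (⟨d + 1, L, m, K, hd, hL⟩ : Params) j) (iterBlockOf j b₀.src) - rep (Mk (⟨d + 1, L, m, K, hd, hL⟩ : Params) j) y))) := by
  obtain ⟨δG, hδG, CG, hCG, hG⟩ := blockBound_LapGE_scaling d L hd hL one_pos
  -- rates: `Q_j* ∘ (Δ_j + w′)` at `κ_Δ/2`, the whole at `δ₂ = min(δ_G/2, κ_Δ/2)`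
  set κΔ : ℝ := kappa166 (d + 1) / (d + 1) with hκΔ
  have hκΔ0 : 0 < κΔ := div_pos (kappa166_pos _) (by positivity)
  set δ₂ : ℝ := min (δG / 2) (κΔ / 2) with hδ₂
  have hδ₂0 : 0 < δ₂ := lt_min (half_pos hδG) (half_pos hκΔ0)
  have hδ₂G : δ₂ < δG := lt_of_le_of_lt (min_le_left _ _) (half_lt_self hδG)
  have hδ₂Δ : δ₂ ≤ κΔ / 2 := min_le_right _ _
  set AΔ : ℝ := MC (d + 1) (kappa166 (d + 1)) * periodConst (kappa166 (d + 1)) d with hAΔ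
  have hAΔ0 : 0 ≤ AΔ := ADelta_nonneg d
  set K₁ : ℝ := latticeConst (d + 1) (κΔ - κΔ / 2) with hK₁
  set K₂ : ℝ := latticeConst (d + 1) (δG - δ₂) with hK₂
  have hK₁0 : 0 ≤ K₁ := latticeConst_nonneg _ (by linarith)
  have hK₂0 : 0 ≤ K₂ := latticeConst_nonneg _ (by linarith)
  have hL0 : 0 < L := by have := hL.2; omega
  haveI : NeZero L := ⟨by omega⟩
  have hLp : (0 : ℝ) < L := by exact_mod_cast hL0
  set C : ℝ := CG * (Real.exp κΔ * (AΔ * ((1 * (d + 1) : ℕ) : ℝ) + 1) * K₁) * K₂ with hC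
  have hC0 : 0 ≤ C := by positivity
  refine ⟨δ₂, hδ₂0, C, hC0, ?_⟩
  intro m K j hc hj Λ' w hw b₀ y
  have hj' : j ≤ m + K := Nat.le_of_succ_le hj
  set N : ℝ := ((L : ℝ) ^ j) ^ (d + 1) with hN
  have hN0 : 0 < N := by positivity
  have hw' : (0 : ℝ) < 1 * ((L : ℝ) ^ j) ^ (d + 1) := by positivity
  have hρ : IsPseudoDist (fun t t' : Site (⟨d + 1, L, m, K, hd, hL⟩ : Params) j => torusSupNorm (Mk (⟨d + 1, L, m, K, hd, hL⟩ : Params) j)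
      (rep (Mk (⟨d + 1, L, m, K, hd, hL⟩ : Params) j) t - rep (Mk (⟨d + 1, L, m, K, hd, hL⟩ : Params) j) t')) :=
    torusDist_isPseudoDist (Mk (⟨d + 1, L, m, K, hd, hL⟩ : Params) j)
  have hK : SumBound (fun t t' : Site (⟨d + 1, L, m, K, hd, hL⟩ : Params) j => torusSupNorm (Mk (⟨d + 1, L, m, K, hd, hL⟩ : Params) j)
      (rep (Mk (⟨d + 1, L, m, K, hd, hL⟩ : Params) j) t - rep (Mk (⟨d + 1, L, m, K, hd, hL⟩ : Params) j) t')) (fun a => latticeConst (d + 1) a) :=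
    torusDist_sumBound (Mk (⟨d + 1, L, m, K, hd, hL⟩ : Params) j)
  -- at `c = L^j`: `κ = N = n^{d+1}` and `η^{d+1} = N⁻¹`
  have hκN : ((L : ℝ) ^ j) ^ 2 / (eta L j ^ (d + 1) * ((L : ℝ) ^ j) ^ 2) = N := by
    rw [hN, eta, inv_pow, div_eq_iff (by positivity)]
    field_simp
  have hηN : (⟨d + 1, L, m, K, hd, hL⟩ : Params).eta j ^ (d + 1) = N⁻¹ := by
    rw [hN, Params.eta, ← inv_pow, ← inv_pow]
  -- (a) the factor bounds
  have hGb := hG m K j hj' hc hw'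
  have hQ : ∀ (b₀ : PBond (⟨d + 1, L, m, K, hd, hL⟩ : Params) 0) (y' : Site (⟨d + 1, L, m, K, hd, hL⟩ : Params) j),
      ∑ b ∈ univ.filter (fun b : PBond (⟨d + 1, L, m, K, hd, hL⟩ : Params) j => b.src = y'),
          |LinearMap.adjoint (tsV1 hc Λ' w).Qv (EuclideanSpace.single b (1 : ℝ)) b₀| ≤
        N⁻¹ * Real.exp κΔ * Real.exp (-(κΔ * torusSupNorm (Mk (⟨d + 1, L, m, K, hd, hL⟩ : Params) j)
          (rep (Mk (⟨d + 1, L, m, K, hd, hL⟩ : Params) j) (iterBlockOf j b₀.src) - rep (Mk (⟨d + 1, L, m, K, hd, hL⟩ : Params) j) y'))) := by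
    intro b₀ y'
    have h := blockBound_Qv_adjoint hc hj' Λ' w hκΔ0.le b₀ y'
    rwa [hηN] at h
  have hΔ : ∀ (b : PBond (⟨d + 1, L, m, K, hd, hL⟩ : Params) j) (y' : Site (⟨d + 1, L, m, K, hd, hL⟩ : Params) j),
      ∑ b' ∈ univ.filter (fun b' : PBond (⟨d + 1, L, m, K, hd, hL⟩ : Params) j => b'.src = y'), |(tsV1 hc Λ' w).Δj (EuclideanSpace.single b' (1 : ℝ)) b| ≤
        N * AΔ * ((1 * (d + 1) : ℕ) : ℝ) * Real.exp (-(κΔ * torusSupNorm (Mk (⟨d + 1, L, m, K, hd, hL⟩ : Params) j)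
          (rep (Mk (⟨d + 1, L, m, K, hd, hL⟩ : Params) j) b.src - rep (Mk (⟨d + 1, L, m, K, hd, hL⟩ : Params) j) y'))) := by
    intro b y'
    have h := blockBound_Δj hc hj Λ' hw b y'
    rwa [hκN] at h
  have hI : ∀ (b : PBond (⟨d + 1, L, m, K, hd, hL⟩ : Params) j) (y' : Site (⟨d + 1, L, m, K, hd, hL⟩ : Params) j),
      ∑ b' ∈ univ.filter (fun b' : PBond (⟨d + 1, L, m, K, hd, hL⟩ : Params) j => b'.src = y'),
          |((1 * ((L : ℝ) ^ j) ^ (d + 1)) • (LinearMap.id : UBond (⟨d + 1, L, m, K, hd, hL⟩ : Params) j →ₗ[ℝ] UBond (⟨d + 1, L, m, K, hd, hL⟩ : Params) j))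
            (EuclideanSpace.single b' (1 : ℝ)) b| ≤
        |1 * ((L : ℝ) ^ j) ^ (d + 1)| * 1 * Real.exp (-(κΔ * torusSupNorm (Mk (⟨d + 1, L, m, K, hd, hL⟩ : Params) j)
          (rep (Mk (⟨d + 1, L, m, K, hd, hL⟩ : Params) j) b.src - rep (Mk (⟨d + 1, L, m, K, hd, hL⟩ : Params) j) y'))) :=
    fun b y' => blockBound_smul (ρ := (fun t t' : Site (⟨d + 1, L, m, K, hd, hL⟩ : Params) j => torusSupNorm (Mk (⟨d + 1, L, m, K, hd, hL⟩ : Params) j)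
      (rep (Mk (⟨d + 1, L, m, K, hd, hL⟩ : Params) j) t - rep (Mk (⟨d + 1, L, m, K, hd, hL⟩ : Params) j) t'))) _
      (fun b : PBond (⟨d + 1, L, m, K, hd, hL⟩ : Params) j => b.src) (fun b : PBond (⟨d + 1, L, m, K, hd, hL⟩ : Params) j => b.src) _
      (fun b y' => blockBound_id hρ (fun b : PBond (⟨d + 1, L, m, K, hd, hL⟩ : Params) j => b.src) κΔ b y') b y'
  have hE : ∀ (b : PBond (⟨d + 1, L, m, K, hd, hL⟩ : Params) j) (y' : Site (⟨d + 1, L, m, K, hd, hL⟩ : Params) j),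
      ∑ b' ∈ univ.filter (fun b' : PBond (⟨d + 1, L, m, K, hd, hL⟩ : Params) j => b'.src = y'),
          |((tsV1 hc Λ' w).Δj + (1 * ((L : ℝ) ^ j) ^ (d + 1)) • (LinearMap.id : UBond (⟨d + 1, L, m, K, hd, hL⟩ : Params) j →ₗ[ℝ] UBond (⟨d + 1, L, m, K, hd, hL⟩ : Params) j))
            (EuclideanSpace.single b' (1 : ℝ)) b| ≤
        N * (AΔ * ((1 * (d + 1) : ℕ) : ℝ) + 1) * Real.exp (-(κΔ * torusSupNorm (Mk (⟨d + 1, L, m, K, hd, hL⟩ : Params) j)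
          (rep (Mk (⟨d + 1, L, m, K, hd, hL⟩ : Params) j) b.src - rep (Mk (⟨d + 1, L, m, K, hd, hL⟩ : Params) j) y'))) := by
    intro b y'
    have h := blockBound_add (ρ := (fun t t' : Site (⟨d + 1, L, m, K, hd, hL⟩ : Params) j => torusSupNorm (Mk (⟨d + 1, L, m, K, hd, hL⟩ : Params) j)
      (rep (Mk (⟨d + 1, L, m, K, hd, hL⟩ : Params) j) t - rep (Mk (⟨d + 1, L, m, K, hd, hL⟩ : Params) j) t'))) _ _
      (fun b : PBond (⟨d + 1, L, m, K, hd, hL⟩ : Params) j => b.src) (fun b : PBond (⟨d + 1, L, m, K, hd, hL⟩ : Params) j => b.src) hΔ hI b y'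
    refine h.trans (le_of_eq ?_)
    rw [abs_of_pos hw', hN]
    ring
  -- (b) `Q_j* ∘ (Δ_j + w′)` at rate `κ_Δ/2`: the factors `N⁻¹` and `N` cancel
  have h1 := blockBound_comp hρ hK (LinearMap.adjoint (tsV1 hc Λ' w).Qv)
    ((tsV1 hc Λ' w).Δj + (1 * ((L : ℝ) ^ j) ^ (d + 1)) • (LinearMap.id : UBond (⟨d + 1, L, m, K, hd, hL⟩ : Params) j →ₗ[ℝ] UBond (⟨d + 1, L, m, K, hd, hL⟩ : Params) j))
    (fun b₀ : PBond (⟨d + 1, L, m, K, hd, hL⟩ : Params) 0 => iterBlockOf j b₀.src) (fun b : PBond (⟨d + 1, L, m, K, hd, hL⟩ : Params) j => b.src)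
    (fun b : PBond (⟨d + 1, L, m, K, hd, hL⟩ : Params) j => b.src)
    (Cf := N⁻¹ * Real.exp κΔ) (Cg := N * (AΔ * ((1 * (d + 1) : ℕ) : ℝ) + 1)) (by positivity) (by positivity)
    (show (0 : ℝ) ≤ κΔ / 2 by positivity) (show κΔ / 2 ≤ κΔ by linarith) (show κΔ / 2 < κΔ by linarith) hQ hE
  -- (c) `(ΔG^{(w′)}) ∘ (Q_j*(Δ_j + w′))` at rate `δ₂`
  have h2 := blockBound_comp hρ hK
    ((∑ ν : Fin (d + 1), ((((L : ℝ) ^ j) • (onE (LinearMap.funLeft ℝ ℝ (fun b : PBond (⟨d + 1, L, m, K, hd, hL⟩ : Params) 0 => (⟨b.src.unshift ν, b.dir⟩ : PBond (⟨d + 1, L, m, K, hd, hL⟩ : Params) 0))) - LinearMap.id) : BondSpace (⟨d + 1, L, m, K, hd, hL⟩ : Params) →ₗ[ℝ] BondSpace (⟨d + 1, L, m, K, hd, hL⟩ : Params))) ∘ₗ ((((L : ℝ) ^ j) • (onE (LinearMap.funLeft ℝ ℝ (fun b : PBond (⟨d + 1, L, m, K, hd, hL⟩ : Params) 0 => (⟨b.src.shift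 ν, b.dir⟩ : PBond (⟨d + 1, L, m, K, hd, hL⟩ : Params) 0))) - LinearMap.id) : BondSpace (⟨d + 1, L, m, K, hd, hL⟩ : Params) →ₗ[ℝ] BondSpace (⟨d + 1, L, m, K, hd, hL⟩ : Params)))) ∘ₗ
      GE (Domains.whole (P := (⟨d + 1, L, m, K, hd, hL⟩ : Params)) j hj') hc (w := fun _ => 1 * ((L : ℝ) ^ j) ^ (d + 1)) (fun _ => hw'))
    (LinearMap.adjoint (tsV1 hc Λ' w).Qv ∘ₗ
      ((tsV1 hc Λ' w).Δj + (1 * ((L : ℝ) ^ j) ^ (d + 1)) • (LinearMap.id : UBond (⟨d + 1, L, m, K, hd, hL⟩ : Params) j →ₗ[ℝ] UBond (⟨d + 1, L, m, K, hd, hL⟩ : Params) j)))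
    (fun b₀ : PBond (⟨d + 1, L, m, K, hd, hL⟩ : Params) 0 => iterBlockOf j b₀.src) (fun b₀ : PBond (⟨d + 1, L, m, K, hd, hL⟩ : Params) 0 => iterBlockOf j b₀.src)
    (fun b : PBond (⟨d + 1, L, m, K, hd, hL⟩ : Params) j => b.src)
    (Cf := CG) (Cg := N⁻¹ * Real.exp κΔ * (N * (AΔ * ((1 * (d + 1) : ℕ) : ℝ) + 1)) * K₁) hCG (by positivity)
    hδ₂0.le hδ₂Δ hδ₂G hGb h1 b₀ y
  -- (d) `ΔH_j = (ΔG^{(w′)})(Q_j*(Δ_j + w′))`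
  have hHj : (∑ ν : Fin (d + 1), ((((L : ℝ) ^ j) • (onE (LinearMap.funLeft ℝ ℝ (fun b : PBond (⟨d + 1, L, m, K, hd, hL⟩ : Params) 0 => (⟨b.src.unshift ν, b.dir⟩ : PBond (⟨d + 1, L, m, K, hd, hL⟩ : Params) 0))) - LinearMap.id) : BondSpace (⟨d + 1, L, m, K, hd, hL⟩ : Params) →ₗ[ℝ] BondSpace (⟨d + 1, L, m, K, hd, hL⟩ : Params))) ∘ₗ ((((L : ℝ) ^ j) • (onE (LinearMap.funLeft ℝ ℝ (fun b : PBond (⟨d + 1, L, m, K, hd, hL⟩ : Params) 0 => (⟨b.src.shift ν, b.dir⟩ : PBond (⟨d + 1, L, m, K, hd, hL⟩ : Params) 0))) - LinearMap.id) : BondSpace (⟨d + 1, L, m, K, hd, hL⟩ : Params) →ₗ[ℝ] BondSpace (⟨d + 1, L, m, K, hd, hL⟩ : Params)))) ∘ₗ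
        (tsV1 hc Λ' w).Hj =
      ((∑ ν : Fin (d + 1), ((((L : ℝ) ^ j) • (onE (LinearMap.funLeft ℝ ℝ (fun b : PBond (⟨d + 1, L, m, K, hd, hL⟩ : Params) 0 => (⟨b.src.unshift ν, b.dir⟩ : PBond (⟨d + 1, L, m, K, hd, hL⟩ : Params) 0))) - LinearMap.id) : BondSpace (⟨d + 1, L, m, K, hd, hL⟩ : Params) →ₗ[ℝ] BondSpace (⟨d + 1, L, m, K, hd, hL⟩ : Params))) ∘ₗ ((((L : ℝ) ^ j) • (onE (LinearMap.funLeft ℝ ℝ (fun b : PBond (⟨d + 1, L, m, K, hd, hL⟩ : Params) 0 => (⟨b.src.shift ν, b.dir⟩ : PBond (⟨d + 1, L, m, K, hd, hL⟩ : Params) 0))) - LinearMap.id) : BondSpace (⟨d + 1, L, m, K, hd, hL⟩ : Params) →ₗ[ℝ] BondSpace (⟨d + 1, L, m, K, hd, hL⟩ : Params)))) ∘ₗ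
          GE (Domains.whole (P := (⟨d + 1, L, m, K, hd, hL⟩ : Params)) j hj') hc (w := fun _ => 1 * ((L : ℝ) ^ j) ^ (d + 1)) (fun _ => hw')) ∘ₗ
        (LinearMap.adjoint (tsV1 hc Λ' w).Qv ∘ₗ
          ((tsV1 hc Λ' w).Δj + (1 * ((L : ℝ) ^ j) ^ (d + 1)) • (LinearMap.id : UBond (⟨d + 1, L, m, K, hd, hL⟩ : Params) j →ₗ[ℝ] UBond (⟨d + 1, L, m, K, hd, hL⟩ : Params) j))) := by
    rw [Hj_eq_GE_comp_V1 hc hj Λ' hw hw', LinearMap.comp_assoc]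
  rw [hHj]
  refine h2.trans (le_of_eq ?_)
  rw [hC, hK₁, hK₂]
  field_simp

end Scaling

end Literature.MathematicalPhysics.QuantumFieldTheory.Balaban1983to89.B6BlockDecayLapHjV1

end
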